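import Summits.Ventures.YMGap.RobustBall.Defs
import HarnessLib

/-!
# RobustBall/AreaLawWDefs — the TIER-2 area-law currency with vertical window (`AreaLawOnBallW`)

HONEST FRAMING: DEFINITIONS only (the one `theorem` is the consistency check `W = 0`).  Strong-coupling / high-temperature LATTICE
statements only: nothing about the continuum limit or a Clay-sense mass gap.  This file types the name RESERVED by rb-theory
(`HOME/rb/ROBUST-BALL-STATEMENT.md` §6(b)) for the honest tier-2 area law of track Y2: the VERBATIM twin of `AreaLawOnBall`
(`RobustBall/Defs`) with the tier-1 ball `ClusterDomainFR ε₀ ε₁ r` (finite range `r`) replaced by the TIER-2 diameter-weighted ball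
`ClusterDomain κ ε₀ ε₁` (NO range cut-off, loads weighted by `e^{κ · diam X}`), the area-law sub-ball `IsSlabLocal mv` (centre-slab
invariance + vertical dependence window `mv`) KEPT.  The two other tier-2 statements of §6 are NOT this one: (a) `AreaLawOnBallC`
(centre invariance only, no vertical window; lit-1, REFUTED by the loop-screening member) and (c) the window-free statement on the
linkwise centre-blind sub-ball (open, method-null).  Discharged in `RobustBall/RobustAreaLawBallW` (ds-4) from any one-link modulus
under Föllmer's weighted row condition.
-/

noncomputable section

open MeasureTheory
open Literature.MathematicalPhysics.QuantumLattice hiding torusNorm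
open Literature.MathematicalPhysics.QuantumFieldTheory hiding ZdEdge

namespace Summit.Ventures.YMGap.RobustBall

variable {d L N : ℕ}

/-- **Area law on the TIER-2 ball with vertical window** (currency C-AL, tier 2; rb-theory's reserved name, ROBUST-BALL-STATEMENT
§6(b)): constants `C, c > 0` such that for every torus `L`, every member `W` of the diameter-weighted ball `ClusterDomain κ ε₀ ε₁`
(no range cut-off) which is slab-local with vertical dependence diameter `mv`, and every rectangular `R × T` Wilson loop,
`|⟨W_{R×T}⟩_{β,W,L}| ≤ C^{2(R+T)} e^{−c R T}` — `AreaLawOnBall` with `ClusterDomainFR ε₀ ε₁ r` replaced by `ClusterDomain κ ε₀ ε₁`.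
Expected constants (ds-4's weighted slab door + rb-p2's reduction): slab clustering `(C₁, C₂) = (8N, κ/n)` on the slice of dimension
`n = d − 1`, `c = κ/(2 n mv)`, `C = max(N, e^{c M₀²}, 1)`, `M₀ = 2 log max((N²)^{mv}·32N, 1)·n/κ`. [folklore] -/
def AreaLawOnBallW (N d : ℕ) (β κ ε₀ ε₁ : ℝ) (mv : ℕ) : Prop :=
  ∃ C c : ℝ, 0 < c ∧ ∀ (L : ℕ) [NeZero L] (W : Perturbation d L N), W ∈ ClusterDomain κ ε₀ ε₁ →
    IsSlabLocal mv W → ∀ (x : Site d L) (i j : Fin d) (R T : ℕ), i ≠ j → 1 ≤ R → 1 ≤ T →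
      2 * R ≤ L → 2 * T ≤ L →
        |W.expectation (fundamentalRep (Fin N)) β (wilsonLoop (fundamentalRep (Fin N)) x i j R T)| ≤
          C ^ (2 * (R + T)) * Real.exp (-c * (R * T))

/-- Consistency target (tier-2 twin of `AreaLawOnBallConsistency`): the tier-2 ball area law contains Wilson's (`W = 0` is a
member). [folklore] -/
def AreaLawOnBallWConsistency (N d : ℕ) (β κ ε₀ ε₁ : ℝ) (mv : ℕ) : Prop :=
  AreaLawOnBallW N d β κ ε₀ ε₁ mv → HasAreaLaw d (fundamentalRep (Fin N)) β

/-- **Consistency of the tier-2 ball area law with the tree's `HasAreaLaw`**: the zero perturbation is a member of every tier-2 ball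
with `0 ≤ ε₀, ε₁` and is slab-local, and its expectation is the Wilson expectation. [folklore] -/
theorem areaLawOnBallWConsistency_of_nonneg (β κ : ℝ) {ε₀ ε₁ : ℝ} (h₀ : 0 ≤ ε₀) (h₁ : 0 ≤ ε₁) (mv : ℕ) :
    AreaLawOnBallWConsistency N d β κ ε₀ ε₁ mv := by
  intro hAL
  obtain ⟨C, c, hc, hW⟩ := hAL
  refine ⟨C, c, hc, fun L _ x i j R T hij hR hT hRL hTL => ?_⟩
  have hz : IsSlabLocal mv (0 : Perturbation d L N) :=
    { center_inv := fun v t z _ U => by simp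
      vert_range := fun X v => ⟨0, fun _ _ _ => rfl⟩ }
  have h := hW L 0 (zero_mem_clusterDomain h₀ h₁) hz x i j R T hij hR hT hRL hTL
  rwa [QuasiLocalGaugePerturbation.expectation_zero] at h

end Summit.Ventures.YMGap.RobustBall

end
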